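import Summits.ValiantsHypothesis.ValiantsHypothesis.Theorems.NcPairingPolynomial
import Summits.ValiantsHypothesis.ValiantsHypothesis.Theorems.NcSawtoothDesignation
import Summits.ValiantsHypothesis.ValiantsHypothesis.Theorems.NcTypedPermanentEventually
import HarnessLib

/-!
# The permanent above the skew regime: the non-skew-depth rung — H4b of O-L6-20 (T2)

THE RUNG. A const-free noncommutative circuit with products of fan-in 1 or 2 computing `PERM_D`
(`ncPerPoly K D`, `D = 6tg`, `t ≥ 4k + 2`) ALL of whose parse trees have NON-SKEW DEPTH at most
`k` (`nsd`, `NcNonSkewDepthShapes`) has size `≥ 2^g / (D + 1)^2` (`ncPerPoly_nsd`); hence for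
every `k, c` and all large `g` (with `t = 4k + 2`) no such circuit has size `≤ D^c + c`
(★ `perNotNcVP_nsd_eventually`). ASSEMBLY (every ingredient landed in this lane):
(1) SUBSTITUTION — `pairSubst K mate` (`NcPairingPolynomial`) maps the circuit into the two-letter
ZERO-CONST model (`zeroConst_substIn`, `binary_substIn`; parse-tree SHAPES are preserved as a set,
`shapes_substIn`, so the non-skew-depth hypothesis transfers) and `PERM_D` onto the pairing
polynomial (`perm_pairing`, H4a); (2) INSTRUMENT — the Hankel interval bound
`hankel_interval_bound` (H2b) bounds the rank of the partial-derivative matrix `flat K Y (·)` of the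
substituted circuit by `(D+1)^2 · 2^δ · size` as soon as every parse tree of size `D` has a
designated interval (`des (ivGood Y δ) · 0 ≠ none`); (3) the interval lemma — for the tilted
sawtooth mask `Y = sawMask t g`, `δ = 3tg − g`, every shape of size `D` with `nsd ≤ k` is
designated (★ `saw_designated`, H3c); (4) RANK — `Y` is exchanged by the pairing `sawMate`, so
the matrix of the pairing polynomial has full rank `2^{3tg}` (`rank_flat_pairPoly`, H4a).
The mask-agnostic consumer is `ncPerPoly_le_of_designation`; `2^{3tg} ≤ (D+1)^2 · 2^{3tg−g} · size`
is the rung, `growthSaw_eventually` its eventual form.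
LABEL: print-KNOWN (LMS16 Theorem 1.3 via FLOS20 Theorem 20's interval route; own mask) ·
kernel-NEW (first PERM lower bound above the skew regime in the tree) ·
RUNG on the commutativity-dial cell (b) · 0 S-currency · closes NO item ·
A_nc stmt-23446 / PerNotNcVP / VP ≠ VNP untouched.
NON-VACUITY: for every D the left-comb circuit Σ_π ((x_{π0,0}·x_{π1,1})·x_{π2,2})⋯x_{π(D−1),D−1}
computes PERM_D inside the const-free binary model with every parse tree a left comb (nsd = 0 ≤ k),
so the class «all parse trees of non-skew depth ≤ k, computing PERM_D» is non-empty at every k and g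
and the binders of ncPerPoly_nsd / perNotNcVP_nsd_eventually carry content; k = 0 contains the skew
circuits of the landed UPT/rotation rungs, k ≥ 1 is strictly above them.
CLASS: the hypothesis «∀ e ∈ circuitPts P, nsd e.1 ≤ k» (every parse tree of P has non-skew depth
≤ k) CONTAINS LMS16's syntactic class of circuits of non-skew depth ≤ k, so ncPerPoly_nsd /
perNotNcVP_nsd_eventually are the STRONGER statements; the names ncPerPoly_nsDepth /
perNotNcVP_nsDepth_eventually of CALL 2626 are not used and no by-name corollary file is built.
MODEL (verbatim for every file): «Circuits ArithCircuit K σ read in FreeAlgebra K σ (ncEval), K a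
field, σ finite; weighted sum gates of any fan-in, product gates of fan-in 1 or 2 (general fan-in:
the landed binz of O-L6-19); the INPUT circuit of a rung is const-free with non-constant output
(print: homogenisation, HWY10 §2 / LMS16 Lemma 4.2 — not formalised; same clause as
ncPerPoly_uptPrint); the instrument (H2) is proved in the wider ZERO-CONST model (const operands
allowed iff 0) so that block substitutions with vanishing entries stay inside it.»
[cite: LimayeMalodSrinivasan2016, Theorem 1.3, §6 (the permanent outside bounded non-skew depth)]
[cite: FijalkowLagardeOhlmannSerre2020, Theorem 13, Theorem 20, §5 (interval route, tilted masks)]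
[cite: HrubesWigdersonYehudayoff2010, Lemma C.5 (reduction by substitution), §2]
[cite: LagardeLimayeSrinivasan2018, §2 (parse trees)]
-/

noncomputable section

namespace Summit.ValiantsHypothesis.ValiantsHypothesis.Theorems.NcPairingPermanent

set_option linter.dupNamespace false
open Literature.Computability.AlgebraicComplexity
  Literature.Computability.AlgebraicComplexity.ArithCircuit
  Summit.ValiantsHypothesis.ValiantsHypothesis.Theorems.NcCentralWidth
  Summit.ValiantsHypothesis.ValiantsHypothesis.Theorems.NcUniqueParseTree
  Summit.ValiantsHypothesis.ValiantsHypothesis.Theorems.NcParseTrees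
  Summit.ValiantsHypothesis.ValiantsHypothesis.Theorems.NcPartialDerivative
  Summit.ValiantsHypothesis.ValiantsHypothesis.Theorems.NcHankelIntervalModel
  Summit.ValiantsHypothesis.ValiantsHypothesis.Theorems.NcHankelIntervalBound
  Summit.ValiantsHypothesis.ValiantsHypothesis.Theorems.NcCayleyDeterminant
  Summit.ValiantsHypothesis.ValiantsHypothesis.Theorems.NcTypedPermanentEventually
  Summit.ValiantsHypothesis.ValiantsHypothesis.Theorems.NcNonSkewDepthShapes
  Summit.ValiantsHypothesis.ValiantsHypothesis.Theorems.NcSawtoothMask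
  Summit.ValiantsHypothesis.ValiantsHypothesis.Theorems.NcSawtoothDesignation
  Summit.ValiantsHypothesis.ValiantsHypothesis.Theorems.NcPairingPolynomial

universe u

variable (K : Type u) [Field K]

/-! ### §1 Substitutions: zero-const model, fan-in, shapes -/

/-- zero-const model after a substitution whose constants are `0` into a const-free circuit.
[cite: HrubesWigdersonYehudayoff2010, Lemma C.5] -/
theorem zeroConst_substIn {σ τ : Type*} (φ : σ → τ ⊕ K) (hφ : ∀ x c, φ x = Sum.inr c → c = 0)
    (P : ArithCircuit K σ) (hc : ∀ g ∈ P.gates, ∀ u ∈ g.args, ∀ c, u ≠ Operand.const c)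
    (ho : ∀ c, P.output ≠ Operand.const c) :
    (∀ g ∈ (P.substIn φ).gates, ∀ u ∈ g.args, ∀ c, u = Operand.const c → c = 0) ∧
      (∀ c, (P.substIn φ).output = Operand.const c → c = 0) := by
  -- a non-constant operand becomes a constant only through `φ _ = inr c`, and then `c = 0`
  have hop : ∀ v : Operand K σ, (∀ c, v ≠ Operand.const c) →
      ∀ c, v.substIn φ = Operand.const c → c = 0 := by
    intro v hv c hvc
    cases v with
    | var x =>
      change Operand.ofInput (φ x) = Operand.const c at hvc
      cases hx : φ x with
      | inl j => rw [hx] at hvc; simp [Operand.ofInput] at hvc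
      | inr c' =>
        rw [hx] at hvc
        simp only [Operand.ofInput, Operand.const.injEq] at hvc
        rw [← hvc]
        exact hφ x c' hx
    | const c' => exact absurd rfl (hv c')
    | gate j => simp [Operand.substIn] at hvc
  refine ⟨fun g hg u hu c huc => ?_, fun c hoc => hop P.output ho c hoc⟩
  simp only [ArithCircuit.substIn, List.mem_map] at hg
  obtain ⟨g', hg', rfl⟩ := hg
  rw [Gate.args_substIn, List.mem_map] at hu
  obtain ⟨u', hu', rfl⟩ := hu
  exact hop u' (hc g' hg' u' hu') c huc

omit [Field K] in
/-- products keep their fan-in under substitution. [cite: HrubesWigdersonYehudayoff2010, Lemma C.5] -/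
theorem binary_substIn {σ τ : Type*} (φ : σ → τ ⊕ K) (P : ArithCircuit K σ)
    (hp : ∀ args, Gate.prod args ∈ P.gates → args.length = 1 ∨ args.length = 2) :
    ∀ args, Gate.prod args ∈ (P.substIn φ).gates → args.length = 1 ∨ args.length = 2 := by
  intro args h
  simp only [ArithCircuit.substIn, List.mem_map] at h
  obtain ⟨g', hg', he⟩ := h
  cases g' with
  | sum a => simp [Gate.substIn] at he
  | prod a =>
    simp only [Gate.substIn, Gate.prod.injEq] at he
    rw [← he, List.length_map]
    exact hp a hg'

/-- parse-tree SHAPES are preserved (as a set, possibly thinned) by an input substitution.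
[cite: LagardeLimayeSrinivasan2018, §2] -/
theorem shapes_substIn {σ τ : Type*} (φ : σ → τ ⊕ K) (P : ArithCircuit K σ) :
    ∀ e ∈ circuitPts (P.substIn φ), ∃ e' ∈ circuitPts P, e'.1 = e.1 := by
  -- pairs: decomposition (substituted side) and introduction (original side)
  have hT : ∀ (L M : List (Shape × FreeAlgebra K τ)), ∀ x ∈ pairPts L M,
      ∃ e ∈ L, ∃ f ∈ M, x = (Shape.node e.1 f.1, e.2 * f.2) := by
    intro L M x hx
    induction L with
    | nil => simp [pairPts] at hx
    | cons e L ihL =>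
      rw [pairPts, List.mem_append, List.mem_map] at hx
      rcases hx with ⟨f, hf, rfl⟩ | hx
      · exact ⟨e, by simp, f, hf, rfl⟩
      · obtain ⟨e', he', f, hf, rfl⟩ := ihL hx
        exact ⟨e', List.mem_cons_of_mem _ he', f, hf, rfl⟩
  have hI : ∀ (L M : List (Shape × FreeAlgebra K σ)), ∀ e ∈ L, ∀ f ∈ M,
      (Shape.node e.1 f.1, e.2 * f.2) ∈ pairPts L M := by
    intro L M e he f hf
    induction L with
    | nil => simp at he
    | cons x L ihL =>
      rw [pairPts, List.mem_append, List.mem_map]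
      rcases List.mem_cons.1 he with rfl | he'
      · exact Or.inl ⟨f, hf, rfl⟩
      · exact Or.inr (ihL he')
  -- from slots to operands: a letter stays a leaf or disappears, a slot is looked up
  have hlift : ∀ (W' : List (List (Shape × FreeAlgebra K τ)))
      (W : List (List (Shape × FreeAlgebra K σ))),
      (∀ j, ∀ e ∈ W'.getD j [], ∃ e' ∈ W.getD j [], e'.1 = e.1) →
      ∀ v : Operand K σ, ∀ e ∈ opPts W' (v.substIn φ), ∃ e' ∈ opPts W v, e'.1 = e.1 := by
    intro W' W hW v e he
    cases v with
    | var x =>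
      refine ⟨(Shape.leaf, FreeAlgebra.ι K x), by simp [opPts], ?_⟩
      change e ∈ opPts W' (Operand.ofInput (φ x)) at he
      cases hx : φ x with
      | inl j =>
        rw [hx] at he
        simp only [Operand.ofInput, opPts, List.mem_singleton] at he
        subst he
        rfl
      | inr c => rw [hx] at he; simp [Operand.ofInput, opPts] at he
    | const c => simp [Operand.substIn, opPts] at he
    | gate j => exact hW j e he
  -- slots, by prefix induction on the gate list
  have hslots : ∀ gs : List (Gate K σ), ∀ j, ∀ e ∈ (ptLists (gs.map (Gate.substIn φ))).getD j [],
      ∃ e' ∈ (ptLists gs).getD j [], e'.1 = e.1 := by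
    intro gs
    induction gs using List.reverseRecOn with
    | nil => intro j e he; simp [ptLists] at he
    | append_singleton gs g ih =>
      have hop := hlift _ _ ih
      intro j e he
      rw [List.map_append, List.map_cons, List.map_nil] at he
      rcases Nat.lt_trichotomy j gs.length with hj | rfl | hj
      · rw [ptLists_getD_append (gs.map (Gate.substIn φ)) [g.substIn φ]
          (by rw [List.length_map]; exact hj)] at he
        rw [ptLists_getD_append gs [g] hj]
        exact ih j e he
      · rw [ptLists_append_singleton, List.getD_append_right _ _ _ _
            ((length_ptLists _).trans (List.length_map _)).le, length_ptLists, List.length_map,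
          Nat.sub_self, List.getD_cons_zero] at he
        rw [ptLists_append_singleton, List.getD_append_right _ _ _ _ (length_ptLists gs).le,
          length_ptLists, Nat.sub_self, List.getD_cons_zero]
        rcases g with args | (_ | ⟨u, _ | ⟨u', _ | ⟨u'', rest⟩⟩⟩)
        · simp only [Gate.substIn, gatePts] at he ⊢
          induction args with
          | nil => simp [sumPts] at he
          | cons a rest iha =>
            rw [List.map_cons, sumPts, List.mem_append, List.mem_map] at he
            rcases he with ⟨f, hf, rfl⟩ | he
            · obtain ⟨f', hf', hff⟩ := hop a.2 f hf
              exact ⟨(f'.1, a.1 • f'.2), by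
                rw [sumPts]; exact List.mem_append_left _ (List.mem_map.2 ⟨f', hf', rfl⟩), hff⟩
            · obtain ⟨e', he', hee⟩ := iha he
              exact ⟨e', by rw [sumPts]; exact List.mem_append_right _ he', hee⟩
        · rw [show gatePts (ptLists (gs.map (Gate.substIn φ))) ((Gate.prod []).substIn φ) = []
            from rfl] at he
          exact absurd he List.not_mem_nil
        · change e ∈ opPts _ (u.substIn φ) at he
          simp only [gatePts]
          exact hop u e he
        · change e ∈ pairPts (opPts _ (u.substIn φ)) (opPts _ (u'.substIn φ)) at he
          simp only [gatePts]
          obtain ⟨x, hx, f, hf, rfl⟩ := hT _ _ e he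
          obtain ⟨x', hx', hxx⟩ := hop u x hx
          obtain ⟨f', hf', hff⟩ := hop u' f hf
          exact ⟨(Shape.node x'.1 f'.1, x'.2 * f'.2), hI _ _ x' hx' f' hf',
            show Shape.node x'.1 f'.1 = Shape.node x.1 f.1 by rw [hxx, hff]⟩
        · rw [show gatePts (ptLists (gs.map (Gate.substIn φ)))
            ((Gate.prod (u :: u' :: u'' :: rest)).substIn φ) = [] from rfl] at he
          exact absurd he List.not_mem_nil
      · have h1 : (ptLists (gs.map (Gate.substIn φ) ++ [g.substIn φ])).length ≤ j := by
          rw [length_ptLists, List.length_append, List.length_map, List.length_singleton]; omega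
        rw [List.getD_eq_default _ _ h1] at he
        exact absurd he List.not_mem_nil
  exact hlift _ _ (hslots P.gates) P.output

/-! ### §2 The mask-agnostic consumer and the rung -/

/-- the mask-agnostic consumer. [cite: FijalkowLagardeOhlmannSerre2020, Theorem 13, Theorem 20]
[cite: LimayeMalodSrinivasan2016, §6] -/
theorem ncPerPoly_le_of_designation {D k δ : ℕ} (Y : Fin D → Bool) (mate : Fin D → Fin D)
    (hm : ∀ c, mate (mate c) = c) (hY : ∀ c, Y (mate c) = !Y c)
    (hdes : ∀ S : Shape, S.size = D → nsd S ≤ k → des (ivGood Y δ) S 0 ≠ none)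
    (P : ArithCircuit K (Fin D × Fin D))
    (hc : ∀ g ∈ P.gates, ∀ u ∈ g.args, ∀ c, u ≠ Operand.const c)
    (hp : ∀ args, Gate.prod args ∈ P.gates → args.length = 1 ∨ args.length = 2)
    (ho : ∀ c, P.output ≠ Operand.const c) (hT : ∀ e ∈ circuitPts P, nsd e.1 ≤ k)
    (h : P.ncEval = ncPerPoly K D) :
    2 ^ Fintype.card {i : Fin D // Y i = true} ≤ (D + 1) ^ 2 * 2 ^ δ * P.size := by
  have hfp : ∀ c, mate c ≠ c := fun c e => by
    have h1 := hY c
    rw [e] at h1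
    exact (Bool.eq_not_self (Y c)).mp h1
  have hφ : ∀ x c, pairSubst K mate x = Sum.inr c → c = 0 := by
    intro x c hx
    unfold pairSubst at hx
    split_ifs at hx
    exact (Sum.inr.inj hx).symm
  obtain ⟨hcQ, hoQ⟩ := zeroConst_substIn K (pairSubst K mate) hφ P hc ho
  have hpQ := binary_substIn K (pairSubst K mate) P hp
  -- the substituted circuit's parse trees of size `D` are designated (shapes are preserved)
  have hdesQ : ∀ e ∈ circuitPts (P.substIn (pairSubst K mate)), e.1.size = D →
      des (ivGood Y δ) e.1 0 ≠ none := by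
    intro e he hsz
    obtain ⟨e', he', hee⟩ := shapes_substIn K (pairSubst K mate) P e he
    rw [← hee] at hsz ⊢
    exact hdes e'.1 hsz (hT e' he')
  have hle := hankel_interval_bound K (P.substIn (pairSubst K mate)) hcQ hpQ hoQ Y δ hdesQ
  rw [ncEval_substIn, h, perm_pairing, degPart_pairPoly K mate hfp, rank_flat_pairPoly K Y mate hm hY,
    Fintype.card_fin, size_substIn] at hle
  exact hle

/-- the non-skew-depth rung (semantic class: every parse tree of `P` has `nsd ≤ k`).
[cite: LimayeMalodSrinivasan2016, Theorem 1.3, §6]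
[cite: FijalkowLagardeOhlmannSerre2020, Theorem 20] -/
theorem ncPerPoly_nsd {t g k : ℕ} (hg : 1 ≤ g) (hk : 4 * k + 2 ≤ t)
    (P : ArithCircuit K (Fin (g * (6 * t)) × Fin (g * (6 * t))))
    (hc : ∀ G ∈ P.gates, ∀ u ∈ G.args, ∀ c, u ≠ Operand.const c)
    (hp : ∀ args, Gate.prod args ∈ P.gates → args.length = 1 ∨ args.length = 2)
    (ho : ∀ c, P.output ≠ Operand.const c) (hT : ∀ e ∈ circuitPts P, nsd e.1 ≤ k)
    (h : P.ncEval = ncPerPoly K (g * (6 * t))) : 2 ^ g ≤ (g * (6 * t) + 1) ^ 2 * P.size := by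
  have hle := ncPerPoly_le_of_designation K (sawMask t g) (sawMate t g) (sawMate_sawMate t g)
    (sawMask_sawMate t g) (fun S hS hn => saw_designated hg hk S hS hn) P hc hp ho hT h
  rw [(card_sawMask t g).1] at hle
  have hsub : g + (g * (3 * t) - g) = g * (3 * t) := by
    have : g * 1 ≤ g * (3 * t) := Nat.mul_le_mul_left g (by omega)
    omega
  refine Nat.le_of_mul_le_mul_right ?_ (Nat.two_pow_pos (g * (3 * t) - g))
  calc 2 ^ g * 2 ^ (g * (3 * t) - g) = 2 ^ (g * (3 * t)) := by rw [← pow_add, hsub]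
    _ ≤ (g * (6 * t) + 1) ^ 2 * 2 ^ (g * (3 * t) - g) * P.size := hle
    _ = (g * (6 * t) + 1) ^ 2 * P.size * 2 ^ (g * (3 * t) - g) := by ring

/-- growth. [cite: LimayeMalodSrinivasan2016, Theorem 1.3] -/
theorem growthSaw_eventually (k c : ℕ) : ∃ g₀ : ℕ, ∀ g, g₀ ≤ g →
    (g * (6 * (4 * k + 2)) + 1) ^ 2 * ((g * (6 * (4 * k + 2))) ^ c + c + 1) < 2 ^ g := by
  obtain ⟨N, hN⟩ := pow_lt_two_pow_eventually (c + 3)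
  refine ⟨N + 8 * (24 * k + 12) ^ (c + 2) + 1, fun g hg => ?_⟩
  have hA : g * (6 * (4 * k + 2)) = (24 * k + 12) * g := by ring
  rw [hA]
  have hD : 2 ≤ (24 * k + 12) * g := by
    have := Nat.mul_le_mul (show 12 ≤ 24 * k + 12 by omega) (show 1 ≤ g by omega)
    omega
  have h2c : c < 2 ^ c := Nat.lt_two_pow_self
  have hc1 : c + 1 ≤ ((24 * k + 12) * g) ^ c :=
    (Nat.succ_le_of_lt h2c).trans (Nat.pow_le_pow_left hD c)
  calc ((24 * k + 12) * g + 1) ^ 2 * (((24 * k + 12) * g) ^ c + c + 1)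
      ≤ (2 * ((24 * k + 12) * g)) ^ 2 * (((24 * k + 12) * g) ^ c + ((24 * k + 12) * g) ^ c) :=
        Nat.mul_le_mul (Nat.pow_le_pow_left (by omega) 2) (by omega)
    _ = 8 * ((24 * k + 12) * g) ^ (c + 2) := by ring
    _ = 8 * (24 * k + 12) ^ (c + 2) * g ^ (c + 2) := by rw [mul_pow, mul_assoc]
    _ ≤ g * g ^ (c + 2) := Nat.mul_le_mul_right _ (by omega)
    _ = g ^ (c + 3) := by ring
    _ < 2 ^ g := hN g (by omega)

/-- ★ rung, eventually form. [cite: LimayeMalodSrinivasan2016, Theorem 1.3, §6]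
[cite: FijalkowLagardeOhlmannSerre2020, Theorem 20] -/
theorem perNotNcVP_nsd_eventually (k c : ℕ) : ∃ g₀ : ℕ, ∀ g, g₀ ≤ g →
    ∀ (P : ArithCircuit ℂ (Fin (g * (6 * (4 * k + 2))) × Fin (g * (6 * (4 * k + 2))))),
      (∀ G ∈ P.gates, ∀ u ∈ G.args, ∀ c, u ≠ Operand.const c) →
      (∀ args, Gate.prod args ∈ P.gates → args.length = 1 ∨ args.length = 2) →
      (∀ c, P.output ≠ Operand.const c) →
      (∀ e ∈ circuitPts P, nsd e.1 ≤ k) →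
      P.ncEval = ncPerPoly ℂ (g * (6 * (4 * k + 2))) → (g * (6 * (4 * k + 2))) ^ c + c < P.size := by
  obtain ⟨g₀, hg₀⟩ := growthSaw_eventually k c
  refine ⟨g₀ + 1, fun g hg P hc hp ho hT h => ?_⟩
  have hle := ncPerPoly_nsd ℂ (t := 4 * k + 2) (by omega) le_rfl P hc hp ho hT h
  have hlt := hg₀ g (by omega)
  by_contra hcon
  have hS : P.size ≤ (g * (6 * (4 * k + 2))) ^ c + c := Nat.not_lt.1 hcon
  exact absurd hlt (Nat.not_lt.2 (hle.trans (Nat.mul_le_mul_left _ (by omega))))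

end Summit.ValiantsHypothesis.ValiantsHypothesis.Theorems.NcPairingPermanent
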